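import Literature.AlgebraicGeometry.HodgeTheory.BettiUniverseTraceIntegral
import Literature.AlgebraicGeometry.HodgeTheory.HodgeModelTopFormOfClass
import HarnessLib

/-!
# `trC (η ∪ conj η') = c · ∫_X ω_η ∧ ω̄_{η'}` for the holomorphic top forms `ω_η` of classes in `FⁿHⁿ`

Family `hodge`, layer `Literature/AlgebraicGeometry/HodgeTheory`. Theorems only; no definition and
no named fact is introduced. Junction of `BettiUniverseTraceIntegral` (`trC = c · ∫` against
closed-form representatives through a REAL multiplicative de Rham comparison `e ⊗ ℂ`) with
`HodgeModelTopFormOfClass` (the holomorphic top form `A.topFormOfClass hX h76 η` of a class, through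
the model's OWN comparison `A.deRham`, granted the bijectivity `h76` of the class map `Ωⁿ ≅ H^{n,0}`,
Voisin I Cor. 7.6, an explicit hypothesis everywhere): the two agree on any Hodge model whose
comparison IS `e ⊗ ℂ` (`hde : ∀ c, A.deRham A.carrier n c = complexifyFun e n c`), and such models
with Kähler data exist for every smooth projective variety (`nonempty_kaehlerRationalDatum` and the
device `B' := {B with deRham := e ⊗ ℂ}` of `hodgeRiemann_X`, done once here:
`exists_kaehlerRationalDatum_deRham_eq`). The pieces `Θ_A⁻¹(H^{p,q})`, hence `Θ_A⁻¹(FʳHᵏ)` and the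
universe's `(BettiUniverse.hodge hHD hX k).F r`, do not depend on the model
(`hodgePQ_independent_of_hodgeModel`, Voisin I Prop. 6.11) — `BettiUniverse.hodge_F_eq_ratF`.

Main statement (`KaehlerRationalDatum.exists_trC_cup_conj_eq_mul_cintegral_topFormOfClass_of_mem_hodge_F`):
for `D` a Kähler–rational datum of the smooth projective `n`-fold `X` with `D.B.deRham = D.e ⊗ ℂ`
and `h76` for `D.B`, there are a constant continuous orientation `o₀` of `X^an` and ONE `c ≠ 0` with
`trC hX (n+n) ((cup X n n ⊗ ℂ) η (conj η')) = c · ∫_{X^an} ω_η ∧ ω̄_{η'}`, `ω_η := D.B.topFormOfClass hX h76 η`,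
for all `η, η' ∈ (BettiUniverse.hodge hHD hX n).F n`.

## References

* [VoisinHodgeI2002] C. Voisin, *Hodge Theory and Complex Algebraic Geometry I*, CUP 2002, §6.1.3
  Prop. 6.11 / Cor. 6.12, §6.3.2, §7.1.1 Def. 7.4, §7.1.2 Thm. 7.10, Cor. 7.6.
* [WarnerGTM94] F. Warner, *Foundations of Differentiable Manifolds and Lie Groups*, GTM 94,
  Springer 1983, Thm. 5.45.
-/

noncomputable section

open scoped Manifold ContDiff TensorProduct ComplexConjugate
open Module
open Literature.AlgebraicTopology.SingularHomology
open Literature.Geometry.Kaehler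
open Literature.NumberTheory.Transcendental
open Literature.AlgebraicGeometry.Motives (bettiCohomology cintegral)

set_option backward.isDefEq.respectTransparency false

namespace Literature.AlgebraicGeometry.HodgeTheory

variable {n : ℕ} {X : Motives.SchemeOver ℂ}

/-! ### The pieces `Θ_A⁻¹(H^{p,q})` do not depend on the model -/

/-- **`Θ_A⁻¹(H^{p,q}(X^an_A)) = Θ_{A'}⁻¹(H^{p,q}(X^an_{A'}))`** for any two Hodge models — the
model-independence of the Hodge type of a class (`hodgePQ_independent_of_hodgeModel`, GAGA +
functoriality of the Hodge decomposition). [cite: VoisinHodgeI2002, §6.1.3 Prop. 6.11 and §7.1.1] -/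
theorem HodgeModel.ratPiece_eq_of_independent (hI : hodgePQ_independent_of_hodgeModel)
    (hX : Motives.IsSmoothProjective n X) (A A' : HodgeModel n X) (k p q : ℕ) :
    A.ratPiece hX k p q = A'.ratPiece hX k p q := by
  ext x
  rw [HodgeModel.mem_ratPiece_iff, HodgeModel.mem_ratPiece_iff, HodgeModel.complexification_apply,
    HodgeModel.complexification_apply, ← hI.isOfHodgeType_iff hX A, ← hI.isOfHodgeType_iff hX A']

/-- Hence `Θ_A⁻¹(Fʳ Hᵏ)` does not depend on the model either. [cite: VoisinHodgeI2002, §7.1.1 Def. 7.4] -/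
theorem HodgeModel.ratF_eq_of_independent (hI : hodgePQ_independent_of_hodgeModel)
    (hX : Motives.IsSmoothProjective n X) (A A' : HodgeModel n X) (k : ℕ) (r : ℤ) :
    A.ratF hX k r = A'.ratF hX k r := by
  rw [HodgeModel.ratF_eq_iSup, HodgeModel.ratF_eq_iSup]
  exact iSup_congr fun pq ↦ iSup_congr fun _ ↦
    HodgeModel.ratPiece_eq_of_independent hI hX A A' k pq.1.1 pq.1.2

/-- **The Hodge filtration of the universe's Hodge structure is `Θ_A⁻¹(F)` for EVERY model `A`**
(it is that of the chosen real model by definition, `BettiUniverse.hodge_F`).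
[cite: VoisinHodgeI2002, §7.1.1 Def. 7.4 and §6.1.3 Prop. 6.11] -/
theorem BettiUniverse.hodge_F_eq_ratF (hHD : exists_isReal_hodgeModel)
    (hI : hodgePQ_independent_of_hodgeModel) (hX : Motives.IsSmoothProjective n X) (A : HodgeModel n X)
    (k : ℕ) (r : ℤ) : (BettiUniverse.hodge hHD hX k).F r = A.ratF hX k r := by
  rw [BettiUniverse.hodge_F, HodgeModel.ratF_eq_of_independent hI hX _ A]

/-- `η ∈ Fᵏ Hᵏ` of the universe's Hodge structure iff `η ∈ Θ_A⁻¹(H^{k,0})`, for every model `A`.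
[cite: VoisinHodgeI2002, §7.1.1 Def. 7.4] -/
theorem BettiUniverse.mem_hodge_F_self_iff_mem_ratPiece (hHD : exists_isReal_hodgeModel)
    (hI : hodgePQ_independent_of_hodgeModel) (hX : Motives.IsSmoothProjective n X) (A : HodgeModel n X)
    (k : ℕ) (x : ℂ ⊗[ℚ] bettiCohomology X k) :
    x ∈ (BettiUniverse.hodge hHD hX k).F k ↔ x ∈ A.ratPiece hX k k 0 := by
  rw [BettiUniverse.hodge_F_eq_ratF hHD hI hX A, ← A.ratF_self_eq_ratPiece hX k]

/-! ### Models whose comparison is a complexified real family -/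

namespace HodgeModel

variable (hX : Motives.IsSmoothProjective n X) (A : HodgeModel n X)
  (e : DeRhamIsoFamily 𝓘(ℝ, A.model)) [MeasurableSpace A.model] [BorelSpace A.model]

omit [MeasurableSpace A.model] [BorelSpace A.model] in
/-- On a model whose comparison is `e ⊗ ℂ` in degree `n`, the class of a holomorphic top form is
its `(e ⊗ ℂ)`-class. [folklore] -/
theorem topHolFormClass_eq_complexifyFun
    (hde : ∀ c, A.deRham A.carrier n c = complexifyFun e n c)
    (w : holFormsInCharts A.model A.carrier n) :
    A.topHolFormClass w =
      complexifyFun e n (complexDeRhamCohomology.mk A.model A.carrier n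
        (holFormsInChartsToClosed A.finrank_model w)) := by
  rw [A.topHolFormClass_apply, hde]

/-- **`trC (η ∪ conj η') = c · ∫ ω_η ∧ ω̄_{η'}` on `Θ_A⁻¹(H^{n,0})`, for a model with comparison
`e ⊗ ℂ`**, `e` multiplicative: given a continuous orientation `o` with `∫_o ≢ 0` on closed top forms
and `h76` (Voisin I Cor. 7.6, a hypothesis), there is ONE `c ≠ 0` with
`trC hX (n+n) ((cup X n n ⊗ ℂ) η (conj η')) = c · ∫_o (topFormOfClass η) ∧ conj (topFormOfClass η')`
for all `η, η' ∈ Θ_A⁻¹(H^{n,0})` (`BettiUniverse.exists_trC_cup_conj_eq_mul_cintegral` with the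
representatives `α := topFormOfClass η`, whose `(e ⊗ ℂ)`-class is `Θ_A η` by
`topHolFormClass_topFormOfClass_of_mem_ratPiece`).
[cite: VoisinHodgeI2002, §6.3.2, Cor. 6.12 and Cor. 7.6] [cite: WarnerGTM94, Thm. 5.45] -/
theorem exists_trC_cup_conj_eq_mul_cintegral_topFormOfClass (hem : e.IsMultiplicative)
    (hde : ∀ c, A.deRham A.carrier n c = complexifyFun e n c)
    [Fact (finrank ℝ A.model = n + n)]
    (o : (x : A.carrier) → Orientation ℝ (TangentSpace 𝓘(ℝ, A.model) x) (Fin (n + n)))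
    (ho : IsContinuousOrientation o)
    (hI : ∃ F : cclosedSmoothForms A.model A.carrier (n + n),
      cintegral o (F : MForm 𝓘(ℝ, A.model) A.carrier ℂ (n + n)) ≠ 0)
    (h76 : Function.Bijective A.topHolFormClassPQ) :
    ∃ c : ℂ, c ≠ 0 ∧ ∀ η η' : ℂ ⊗[ℚ] bettiCohomology X n,
      η ∈ A.ratPiece hX n n 0 → η' ∈ A.ratPiece hX n n 0 →
        BettiUniverse.trC hX (n + n) (LinearMap.BilinMap.baseChange ℂ (BettiUniverse.cup X n n) η
            (Motives.HodgeStructure.conj η')) =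
          c * cintegral o
            ((A.topFormOfClass hX h76 η : MForm 𝓘(ℝ, A.model) A.carrier ℂ n).wedge
              (A.topFormOfClass hX h76 η' : MForm 𝓘(ℝ, A.model) A.carrier ℂ n).conj) := by
  obtain ⟨c, hc0, -, hB⟩ :=
    BettiUniverse.exists_trC_cup_conj_eq_mul_cintegral hX A e hem (two_mul n).symm o ho hI
  refine ⟨c, hc0, fun η η' hη hη' ↦ ?_⟩
  -- the `(e ⊗ ℂ)`-class of the holomorphic top form of a class in `Θ_A⁻¹(H^{n,0})` is the class
  have key : ∀ {ξ : ℂ ⊗[ℚ] bettiCohomology X n}, ξ ∈ A.ratPiece hX n n 0 →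
      A.complexification hX n ξ =
        complexifyFun e n (complexDeRhamCohomology.mk A.model A.carrier n
          (holFormsInChartsToClosed A.finrank_model (A.topFormOfClass hX h76 ξ))) :=
    fun hξ ↦ by
      rw [← A.topHolFormClass_topFormOfClass_of_mem_ratPiece hX h76 hξ]
      exact A.topHolFormClass_eq_complexifyFun e hde _
  have h := hB η η' (holFormsInChartsToClosed A.finrank_model (A.topFormOfClass hX h76 η))
    (holFormsInChartsToClosed A.finrank_model (A.topFormOfClass hX h76 η')) (key hη) (key hη')
  rw [coe_holFormsInChartsToClosed, coe_holFormsInChartsToClosed] at h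
  exact h

end HodgeModel

/-! ### Kähler–rational data with comparison `e ⊗ ℂ` -/

/-- **Every smooth projective variety has a Kähler–rational datum whose model's comparison IS the
complexified real family `D.e ⊗ ℂ`** (take any datum, `nonempty_kaehlerRationalDatum`, and re-equip
its model with `D.e ⊗ ℂ`, natural by `complexify_isNatural` — the device `B'` of `hodgeRiemann_X`;
all other data are unchanged). [cite: VoisinHodgeI2002, §7.1.2 Thm. 7.10 and §6.1.3 Cor. 6.12] -/
theorem exists_kaehlerRationalDatum_deRham_eq (hX : Motives.IsSmoothProjective n X) :
    ∃ D : KaehlerRationalDatum n X,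
      ∀ (k : ℕ) (c : complexDeRhamCohomology D.B.model D.B.carrier k),
        D.B.deRham D.B.carrier k c = complexifyFun D.e k c := by
  obtain ⟨D⟩ := nonempty_kaehlerRationalDatum hX
  exact ⟨{ D with
      B := { D.B with
        deRham := D.e.complexify
        deRham_isNatural := DeRhamIsoFamily.complexify_isNatural D.isNatural } },
    fun _ _ ↦ rfl⟩

namespace KaehlerRationalDatum

variable (D : KaehlerRationalDatum n X) (hX : Motives.IsSmoothProjective n X)
  [MeasurableSpace D.B.model] [BorelSpace D.B.model]

omit [MeasurableSpace D.B.model] [BorelSpace D.B.model] in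
/-- A model with comparison `e ⊗ ℂ` is real. [cite: VoisinHodgeI2002, §6.1.3 Cor. 6.12] -/
theorem isReal_of_deRham_eq
    (hde : ∀ (k : ℕ) (c : complexDeRhamCohomology D.B.model D.B.carrier k),
      D.B.deRham D.B.carrier k c = complexifyFun D.e k c) :
    D.B.IsReal := fun k w ↦ by
  rw [hde, hde]
  exact D.e.complexify_isReal D.B.carrier k w

/-- **`trC (η ∪ conj η') = c · ∫_{X^an} ω_η ∧ ω̄_{η'}` on `Θ⁻¹(H^{n,0})` for a Kähler–rational datum
with comparison `D.e ⊗ ℂ`**: the orientation and the non-vanishing of `∫` are discharged by the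
Kähler volume form (`KaehlerRationalDatum.exists_orientation_cintegral_ne_zero`); `h76` (Voisin I
Cor. 7.6) stays a hypothesis. [cite: VoisinHodgeI2002, §6.3.2, Cor. 6.12 and Cor. 7.6]
[cite: WarnerGTM94, Thm. 5.45] -/
theorem exists_trC_cup_conj_eq_mul_cintegral_topFormOfClass
    (hde : ∀ c, D.B.deRham D.B.carrier n c = complexifyFun D.e n c)
    (h76 : Function.Bijective D.B.topHolFormClassPQ) [Fact (finrank ℝ D.B.model = n + n)] :
    ∃ (o₀ : Orientation ℝ D.B.model (Fin (n + n))) (c : ℂ),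
      IsContinuousOrientation (I := 𝓘(ℝ, D.B.model)) (M := D.B.carrier) (fun _ ↦ o₀) ∧ c ≠ 0 ∧
      ∀ η η' : ℂ ⊗[ℚ] bettiCohomology X n, η ∈ D.B.ratPiece hX n n 0 → η' ∈ D.B.ratPiece hX n n 0 →
        BettiUniverse.trC hX (n + n) (LinearMap.BilinMap.baseChange ℂ (BettiUniverse.cup X n n) η
            (Motives.HodgeStructure.conj η')) =
          c * cintegral (fun _ : D.B.carrier ↦ o₀)
            ((D.B.topFormOfClass hX h76 η : MForm 𝓘(ℝ, D.B.model) D.B.carrier ℂ n).wedge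
              (D.B.topFormOfClass hX h76 η' : MForm 𝓘(ℝ, D.B.model) D.B.carrier ℂ n).conj) := by
  obtain ⟨o₀, ho, hI⟩ := D.exists_orientation_cintegral_ne_zero hX (two_mul n).symm
  obtain ⟨c, hc0, h⟩ := D.B.exists_trC_cup_conj_eq_mul_cintegral_topFormOfClass hX D.e
    D.isMultiplicative hde (fun _ ↦ o₀) ho hI h76
  exact ⟨o₀, c, ho, hc0, h⟩

/-- **The geometric side of `InnerEmbAt`/C2, whole**: for `η, η' ∈ FⁿHⁿ` of the universe's Hodge
structure `BettiUniverse.hodge hHD hX n` (whatever real model is behind it — `FⁿHⁿ = Θ_{D.B}⁻¹(H^{n,0})`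
by model-independence), `trC hX (n+n) ((cup X n n ⊗ ℂ) η (conj η')) = c · ∫_{X^an} ω_η ∧ ω̄_{η'}`
with `ω_η := D.B.topFormOfClass hX h76 η`, one constant continuous orientation and ONE `c ≠ 0`.
[cite: VoisinHodgeI2002, §6.3.2, Cor. 7.6 and §7.1.1 Def. 7.4] [cite: WarnerGTM94, Thm. 5.45] -/
theorem exists_trC_cup_conj_eq_mul_cintegral_topFormOfClass_of_mem_hodge_F
    (hHD : exists_isReal_hodgeModel) (hI : hodgePQ_independent_of_hodgeModel)
    (hde : ∀ c, D.B.deRham D.B.carrier n c = complexifyFun D.e n c)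
    (h76 : Function.Bijective D.B.topHolFormClassPQ) [Fact (finrank ℝ D.B.model = n + n)] :
    ∃ (o₀ : Orientation ℝ D.B.model (Fin (n + n))) (c : ℂ),
      IsContinuousOrientation (I := 𝓘(ℝ, D.B.model)) (M := D.B.carrier) (fun _ ↦ o₀) ∧ c ≠ 0 ∧
      ∀ η η' : ℂ ⊗[ℚ] bettiCohomology X n, η ∈ (BettiUniverse.hodge hHD hX n).F n →
        η' ∈ (BettiUniverse.hodge hHD hX n).F n →
        BettiUniverse.trC hX (n + n) (LinearMap.BilinMap.baseChange ℂ (BettiUniverse.cup X n n) η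
            (Motives.HodgeStructure.conj η')) =
          c * cintegral (fun _ : D.B.carrier ↦ o₀)
            ((D.B.topFormOfClass hX h76 η : MForm 𝓘(ℝ, D.B.model) D.B.carrier ℂ n).wedge
              (D.B.topFormOfClass hX h76 η' : MForm 𝓘(ℝ, D.B.model) D.B.carrier ℂ n).conj) := by
  obtain ⟨o₀, c, ho, hc0, h⟩ := D.exists_trC_cup_conj_eq_mul_cintegral_topFormOfClass hX hde h76
  refine ⟨o₀, c, ho, hc0, fun η η' hη hη' ↦ h η η' ?_ ?_⟩
  · exact (BettiUniverse.mem_hodge_F_self_iff_mem_ratPiece hHD hI hX D.B n η).1 (by exact_mod_cast hη)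
  · exact (BettiUniverse.mem_hodge_F_self_iff_mem_ratPiece hHD hI hX D.B n η').1 (by exact_mod_cast hη')

/-- **Surface case, literal degrees** (the shape of `InnerEmbAt`/C2 for the Picard modular surface:
`trC hX 4 ((cup X 2 2 ⊗ ℂ) η (conj η'))`, `η, η' ∈ F²H²`). [cite: VoisinHodgeI2002, §6.3.2, Cor. 7.6 and §7.1.1 Def. 7.4]
[cite: WarnerGTM94, Thm. 5.45] -/
theorem exists_trC_cup_conj_eq_mul_cintegral_topFormOfClass_surface {X : Motives.SchemeOver ℂ}
    (D : KaehlerRationalDatum 2 X) (hX : Motives.IsSmoothProjective 2 X)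
    [MeasurableSpace D.B.model] [BorelSpace D.B.model]
    (hHD : exists_isReal_hodgeModel) (hI : hodgePQ_independent_of_hodgeModel)
    (hde : ∀ c, D.B.deRham D.B.carrier 2 c = complexifyFun D.e 2 c)
    (h76 : Function.Bijective D.B.topHolFormClassPQ) [Fact (finrank ℝ D.B.model = 4)] :
    ∃ (o₀ : Orientation ℝ D.B.model (Fin 4)) (c : ℂ),
      IsContinuousOrientation (I := 𝓘(ℝ, D.B.model)) (M := D.B.carrier) (fun _ ↦ o₀) ∧ c ≠ 0 ∧
      ∀ η η' : ℂ ⊗[ℚ] bettiCohomology X 2, η ∈ (BettiUniverse.hodge hHD hX 2).F 2 →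
        η' ∈ (BettiUniverse.hodge hHD hX 2).F 2 →
        BettiUniverse.trC hX 4 (LinearMap.BilinMap.baseChange ℂ (BettiUniverse.cup X 2 2) η
            (Motives.HodgeStructure.conj η')) =
          c * cintegral (fun _ : D.B.carrier ↦ o₀)
            ((D.B.topFormOfClass hX h76 η : MForm 𝓘(ℝ, D.B.model) D.B.carrier ℂ 2).wedge
              (D.B.topFormOfClass hX h76 η' : MForm 𝓘(ℝ, D.B.model) D.B.carrier ℂ 2).conj) := by
  obtain ⟨o₀, c, ho, hc0, h⟩ :=
    D.exists_trC_cup_conj_eq_mul_cintegral_topFormOfClass_of_mem_hodge_F hX hHD hI hde h76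
  exact ⟨o₀, c, ho, hc0, h⟩

end KaehlerRationalDatum

end Literature.AlgebraicGeometry.HodgeTheory

end
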